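import Mathlib
import Summits.BirchSwinnertonDyer.BirchSwinnertonDyer.Theorems.ResidualThetaTransportAtTwoSignedMuSeedAtTwoPlusNonsquareDescentHilbertNinety
import HarnessLib

/-!
# Non-square descent — THE CAPITULATION SPLIT `[P_m^G : P_n] ∣ [I_m^G : I_n] · #ker(Cl_n → Cl_m)` and the composed module form of stub S2's
# Herbrand/capitulation bound «`[𝓔_n^χ : N_{m,n}𝓔_m^χ] ∣ [I_m^{G,χ} : I_n^χ] · #ker(A_n^χ → A_m^χ)`» (line `nonsquare-descent`) —
# seed crux `SignedMuSeedAtTwoPlus` stmt-BirchSwinnertonDyer-21438 (parent Kμ⁺ `SignedMuVanishingAtTwoPlus` stmt-BirchSwinnertonDyer-20689,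
# route ResidualThetaTransportAtTwo), line card `Cruxes/SignedMuSeedAtTwoPlus/Lines/nonsquare-descent.md`

Cell `bsd-wall`, width seat `bsd-wall-rtt-p4-w2` g19 (`--supports`, closes nothing).  THEOREMS ONLY; BSD is not proved by this and nothing
arithmetic is asserted: module algebra over a commutative ring `R` with two scalars `ω ν`, in the index currency `Herbrand.index T S = |T/(S ∩ T)|`.

Stub S2 of the card: «`#B'_n ≤ #F^χ·#(Q'/ω_nQ')` (Herbrand quotient 1 on χ-parts, `H¹(G,E_m) ≅ P_m^G/P_n`, the ramified-prime term Δ-trivial,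
capitulation `≤ #X^χ[ν_{m,n}] ≤ #F^χ` because `𝔓` is the unique, totally ramified prime)».  After `…NormIndexSplit` (g18), `…HerbrandIndex` and
`…HilbertNinety` (this seat) the chain reads `[𝓔_n^χ : N_{m,n}𝓔_m^χ] = #H¹(G_{m,n}, 𝓔_m^χ) = [P_m^G : P_n]`.  THIS FILE is the last algebraic link:
with `ι : B → I` the principal-ideal map (`B` = `M_m^×`, `I` = ideals of `M_m`, kernel `A` = units, range `P = P_m`), `I_n ≤ I^G = I[ω]` the ideals
extended from `M_n` and `P_n = ι(B[ω]) ≤ I_n` the principal ones,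

  `[P^G : P_n] = [P^G : P ∩ I_n] · [P ∩ I_n : P_n]`,   `[P^G : P ∩ I_n] ∣ [I^G : I_n]`,   `[P ∩ I_n : P_n] = #ker(I_n/P_n → I/P)`,

so **`[P^G : P_n] ∣ [I^G : I_n] · #ker(Cl_n → Cl_m)`** (`index_inf_torsionBy_dvd`, `index_torsionBy_quotient_dvd`) and, composed with the two
companion files, **`(A[ω] : νA) ∣ (I[ω] : I_n) · #ker(I_n/P_n → I/P)`** for `A = ker ι` containing a free cyclic `R∙u` (annihilator exactly
`(ν ω)`) of finite index, `B` killed by `ν ω` with `B[ν] ≤ ωB` (`index_invariants_norms_dvd`).  What stays arithmetic: `[I^{G,χ} : I_n^χ] = 1`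
(the quotient is generated by the unique ramified prime, on which `Δ` acts trivially — `eq_zero_of_fixed_of_eigen` is the one-line reason a
`Δ`-fixed vector has no `χ ≠ 1` component; with that hypothesis: `index_invariants_norms_dvd_natCard_ker`) and `#ker(A_n^χ → A_m^χ) ≤ #F^χ`.

* §1 `comap_ker_lsmul_eq_comap_torsionBy` (`{b | ω b ∈ ker ι} = ι⁻¹(I[ω])`), **`index_torsionBy_quotient_eq_index_range`**
  (`((B ⧸ ker ι)[ω] : im B[ω]) = (range ι ∩ I[ω] : ι(B[ω]))` — transport of `…HilbertNinety`'s right-hand side along `ι`).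
* §2 `ker_mapQ_eq`, **`natCard_ker_mapQ_eq_index`** (`#ker(I_n/P_n → I/P) = (P ∩ I_n : P_n)`).
* §3 **`index_inf_torsionBy_dvd`** (`(P ∩ I[ω] : P_n) ∣ (I[ω] : I_n) · (P ∩ I_n : P_n)` for `P_n ≤ I_n ≤ I[ω]`, `P_n ≤ P`), `index_torsionBy_quotient_dvd`.
* §4 the composed chain `index_invariants_norms_dvd`, `index_invariants_norms_dvd_natCard_ker`; §5 `eq_zero_of_fixed_of_eigen`.

[folklore]
-/

set_option autoImplicit false
-- the Theorems namespace of this sub repeats the summit name by design (D-0017 nested layout)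
set_option linter.dupNamespace false

open scoped Pointwise nonZeroDivisors
open Literature.Algebra.Homology

namespace Summit.BirchSwinnertonDyer.BirchSwinnertonDyer.Theorems.SignedMuAtTwo.NonsquareDescent

variable {R : Type*} [CommRing R] {B : Type*} [AddCommGroup B] [Module R B] {I : Type*} [AddCommGroup I] [Module R I]

/-! ## §1 Transport of `((B ⧸ A)[ω] : im B[ω])` along the principal-ideal map `ι` (`A = ker ι`) -/

/-- `{b | ω b ∈ ker ι} = ι⁻¹(I[ω])`. [folklore] -/
theorem comap_ker_lsmul_eq_comap_torsionBy (ι : B →ₗ[R] I) (ω : R) :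
    (LinearMap.ker ι).comap (DistribSMul.toLinearMap R B ω) = (Submodule.torsionBy R I ω).comap ι := by
  ext b
  rw [Submodule.mem_comap, DistribSMul.toLinearMap_apply, LinearMap.mem_ker, map_smul, Submodule.mem_comap,
    Submodule.mem_torsionBy_iff]

/-- **`((B ⧸ ker ι)[ω] : im B[ω]) = (range ι ∩ I[ω] : ι(B[ω]))`** — «`[P_m^G : P_n]` read inside the ideal group». [folklore] -/
theorem index_torsionBy_quotient_eq_index_range (ι : B →ₗ[R] I) (ω : R) :
    Herbrand.index (Submodule.torsionBy R (B ⧸ LinearMap.ker ι) ω) ((Submodule.torsionBy R B ω).map (LinearMap.ker ι).mkQ) =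
      Herbrand.index (LinearMap.range ι ⊓ Submodule.torsionBy R I ω) ((Submodule.torsionBy R B ω).map ι) := by
  rw [← index_comap_lsmul_eq_index_torsionBy_quotient, comap_ker_lsmul_eq_comap_torsionBy, ← Submodule.map_comap_eq,
    index_map_map_eq, sup_comm]

/-! ## §2 The capitulation kernel `ker(I_n/P_n → I/P)` has order `(P ∩ I_n : P_n)` -/

section Capitulation

variable (P In Pn : Submodule R I)

/-- `P_n ≤ P` makes `I_n/P_n → I/P` well defined. [folklore] -/
theorem comap_subtype_mono (hP : Pn ≤ P) : Pn.comap In.subtype ≤ P.comap In.subtype := Submodule.comap_mono hP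

/-- The kernel of `I_n/P_n → I/P` is `(P ∩ I_n)/P_n`. [folklore] -/
theorem ker_mapQ_eq (hP : Pn ≤ P) :
    LinearMap.ker (Submodule.mapQ (Pn.comap In.subtype) P In.subtype (comap_subtype_mono P In Pn hP)) =
      (P.comap In.subtype).map (Pn.comap In.subtype).mkQ := by
  unfold Submodule.mapQ
  rw [Submodule.ker_liftQ, LinearMap.ker_comp, Submodule.ker_mkQ]

/-- **`#ker(I_n/P_n → I/P) = (P ∩ I_n : P_n)`** for `P_n ≤ I_n`, `P_n ≤ P` («ideals of level `n` that capitulate, modulo principal ones»).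
[folklore] -/
theorem natCard_ker_mapQ_eq_index (hIn : Pn ≤ In) (hP : Pn ≤ P) :
    Nat.card (LinearMap.ker (Submodule.mapQ (Pn.comap In.subtype) P In.subtype (comap_subtype_mono P In Pn hP))) =
      Herbrand.index (P ⊓ In) Pn := by
  rw [ker_mapQ_eq P In Pn hP, card_map_eq_index_ker, Submodule.ker_mkQ, index_comap_subtype, inf_eq_right.2 hIn, inf_comm]

end Capitulation

/-! ## §3 The split `(P ∩ I[ω] : P_n) ∣ (I[ω] : I_n) · (P ∩ I_n : P_n)` -/

section Split

variable (P In Pn : Submodule R I) (ω : R)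

/-- `(P ∩ I[ω] : P ∩ I_n) ∣ (I[ω] : I_n)` for `I_n ≤ I[ω]` («the part of `P^G/P_n` mapping to `I^G/I_n`, the ramified-prime term»). [folklore] -/
theorem index_inf_torsionBy_inf_dvd (hIn : In ≤ Submodule.torsionBy R I ω) :
    Herbrand.index (P ⊓ Submodule.torsionBy R I ω) (P ⊓ In) ∣ Herbrand.index (Submodule.torsionBy R I ω) In := by
  have h₂ : (P ⊓ Submodule.torsionBy R I ω) ⊔ In ≤ Submodule.torsionBy R I ω := sup_le inf_le_right hIn
  have t := index_mul_index (le_sup_right : In ≤ (P ⊓ Submodule.torsionBy R I ω) ⊔ In) h₂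
  rw [Herbrand.index_sup, ← Herbrand.index_inf_left (P ⊓ Submodule.torsionBy R I ω) In, inf_assoc,
    inf_eq_right.2 hIn] at t
  exact Dvd.intro_left _ t

/-- **THE SPLIT `(P ∩ I[ω] : P_n) ∣ (I[ω] : I_n) · (P ∩ I_n : P_n)`** for `P_n ≤ I_n ≤ I[ω]`, `P_n ≤ P`: `[P^G : P_n] = [P^G : P ∩ I_n]·[P ∩ I_n : P_n]`
and the first factor divides `[I^G : I_n]`. [folklore] -/
theorem index_inf_torsionBy_dvd (hIn : In ≤ Submodule.torsionBy R I ω) (hPnIn : Pn ≤ In) (hPnP : Pn ≤ P) :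
    Herbrand.index (P ⊓ Submodule.torsionBy R I ω) Pn ∣
      Herbrand.index (Submodule.torsionBy R I ω) In * Herbrand.index (P ⊓ In) Pn := by
  have h₁ : Pn ≤ P ⊓ In := le_inf hPnP hPnIn
  have h₂ : P ⊓ In ≤ P ⊓ Submodule.torsionBy R I ω := inf_le_inf_left P hIn
  rw [← index_mul_index h₁ h₂]
  exact mul_dvd_mul_right (index_inf_torsionBy_inf_dvd P In ω hIn) _

end Split

/-! ## §4 The composed chain -/

section Chain

variable {ω ν : R}

/-- `ι(B[ω]) ≤ I_n` makes `I_n/ι(B[ω]) → I/range ι` well defined. [folklore] -/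
theorem comap_subtype_map_le (ι : B →ₗ[R] I) (ω : R) (In : Submodule R I) :
    ((Submodule.torsionBy R B ω).map ι).comap In.subtype ≤ (LinearMap.range ι).comap In.subtype :=
  Submodule.comap_mono LinearMap.map_le_range

/-- **`[P^G : P_n] ∣ [I^G : I_n] · #ker(Cl_n → Cl_m)`**: with `ι : B → I` (principal-ideal map), `P_n = ι(B[ω]) ≤ I_n ≤ I[ω]`:
`((B ⧸ ker ι)[ω] : im B[ω]) ∣ (I[ω] : I_n) · #ker(I_n/P_n → I/range ι)`. [folklore] -/
theorem index_torsionBy_quotient_dvd (ι : B →ₗ[R] I) (ω : R) (In : Submodule R I)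
    (hIn : In ≤ Submodule.torsionBy R I ω) (hPn : (Submodule.torsionBy R B ω).map ι ≤ In) :
    Herbrand.index (Submodule.torsionBy R (B ⧸ LinearMap.ker ι) ω) ((Submodule.torsionBy R B ω).map (LinearMap.ker ι).mkQ) ∣
      Herbrand.index (Submodule.torsionBy R I ω) In *
        Nat.card (LinearMap.ker (Submodule.mapQ (((Submodule.torsionBy R B ω).map ι).comap In.subtype) (LinearMap.range ι)
          In.subtype (comap_subtype_map_le ι ω In))) := by
  rw [index_torsionBy_quotient_eq_index_range,
    natCard_ker_mapQ_eq_index (LinearMap.range ι) In _ hPn LinearMap.map_le_range]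
  exact index_inf_torsionBy_dvd (LinearMap.range ι) In _ ω hIn hPn LinearMap.map_le_range

/-- **THE MODULE FORM OF STUB S2's HERBRAND/CAPITULATION BOUND: `(A[ω] : νA) ∣ (I[ω] : I_n) · #ker(I_n/P_n → I/P)`** —
«`[𝓔_n^χ : N_{m,n}𝓔_m^χ] ∣ [I_m^{G,χ} : I_n^χ] · #ker(A_n^χ → A_m^χ)`»: `B` killed by `ν ω` (`ω`, `ν` non-zero-divisors) with `B[ν] ≤ ωB`
(Hilbert 90); `ι : B → I` linear with kernel `A` containing `u` with annihilator EXACTLY `(ν ω)` and `A ⧸ R∙u` finite (stub S1); `I_n ≤ I[ω]`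
containing `ι(B[ω])`.  (`…HerbrandIndex` ∘ `…HilbertNinety` ∘ §3.) [folklore] -/
theorem index_invariants_norms_dvd (hω : ω ∈ R⁰) (hν : ν ∈ R⁰) (hB : ∀ b : B, (ν * ω) • b = 0)
    (h90 : Submodule.torsionBy R B ν ≤ ω • (⊤ : Submodule R B)) (ι : B →ₗ[R] I) {u : LinearMap.ker ι}
    (hu : ∀ r : R, r • u = 0 → ν * ω ∣ r) [Finite (LinearMap.ker ι ⧸ Submodule.span R {u})]
    (In : Submodule R I) (hIn : In ≤ Submodule.torsionBy R I ω) (hPn : (Submodule.torsionBy R B ω).map ι ≤ In) :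
    Herbrand.index (Submodule.torsionBy R (LinearMap.ker ι) ω) (ν • (⊤ : Submodule R (LinearMap.ker ι))) ∣
      Herbrand.index (Submodule.torsionBy R I ω) In *
        Nat.card (LinearMap.ker (Submodule.mapQ (((Submodule.torsionBy R B ω).map ι).comap In.subtype) (LinearMap.range ι)
          In.subtype (comap_subtype_map_le ι ω In))) := by
  rw [index_invariants_norms_eq_index_torsionBy_quotient hω hν hB h90 (LinearMap.ker ι) hu]
  exact index_torsionBy_quotient_dvd ι ω In hIn hPn

/-- The same when the ramified term is trivial, `(I[ω] : I_n) = 1` (on `χ`-parts: `I^G/I_n` is generated by the unique ramified prime, fixed by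
`Δ`): **`(A[ω] : νA) ∣ #ker(I_n/P_n → I/P)`** — «`[𝓔_n^χ : N_{m,n}𝓔_m^χ] ≤ #ker(A_n^χ → A_m^χ)`». [folklore] -/
theorem index_invariants_norms_dvd_natCard_ker (hω : ω ∈ R⁰) (hν : ν ∈ R⁰) (hB : ∀ b : B, (ν * ω) • b = 0)
    (h90 : Submodule.torsionBy R B ν ≤ ω • (⊤ : Submodule R B)) (ι : B →ₗ[R] I) {u : LinearMap.ker ι}
    (hu : ∀ r : R, r • u = 0 → ν * ω ∣ r) [Finite (LinearMap.ker ι ⧸ Submodule.span R {u})]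
    (In : Submodule R I) (hIn : In ≤ Submodule.torsionBy R I ω) (hPn : (Submodule.torsionBy R B ω).map ι ≤ In)
    (hram : Herbrand.index (Submodule.torsionBy R I ω) In = 1) :
    Herbrand.index (Submodule.torsionBy R (LinearMap.ker ι) ω) (ν • (⊤ : Submodule R (LinearMap.ker ι))) ∣
      Nat.card (LinearMap.ker (Submodule.mapQ (((Submodule.torsionBy R B ω).map ι).comap In.subtype) (LinearMap.range ι)
        In.subtype (comap_subtype_map_le ι ω In))) := by
  have h := index_invariants_norms_dvd hω hν hB h90 ι hu In hIn hPn
  rwa [hram, one_mul] at h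

end Chain

/-! ## §5 Why the ramified term dies on `χ`-parts: a `Δ`-fixed vector has no `χ ≠ 1` eigencomponent -/

/-- If `δ` fixes `q` and `q` is a `ζ`-eigenvector of `δ` with `1 − ζ` a unit (e.g. `ζ = ζ₃ ∈ ℤ₂[ζ₃]`, `N(1 − ζ₃) = 3 ∈ ℤ₂ˣ`), then `q = 0`:
the `χ`-part (`χ(δ) = ζ ≠ 1`) of a module with trivial `Δ`-action vanishes. [folklore] -/
theorem eq_zero_of_fixed_of_eigen {Q : Type*} [AddCommGroup Q] [Module R Q] (δ : Q →ₗ[R] Q) {ζ : R} (hζ : IsUnit (1 - ζ))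
    {q : Q} (hfix : δ q = q) (heig : δ q = ζ • q) : q = 0 := by
  have h : (1 - ζ) • q = 0 := by rw [sub_smul, one_smul, ← heig, hfix, sub_self]
  obtain ⟨w, hw⟩ := hζ
  calc q = ((w⁻¹ : Rˣ) : R) • ((w : R) • q) := by rw [smul_smul, Units.inv_mul, one_smul]
    _ = 0 := by rw [hw, h, smul_zero]

end Summit.BirchSwinnertonDyer.BirchSwinnertonDyer.Theorems.SignedMuAtTwo.NonsquareDescent
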